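/-
Copyright (c) 2026 the pub-hodgecm-mathlib formalisation cell (harness21).  Prover seat hodgecm-mathlib-K2E1-p11 (g6), Track B ∕ K2-LIT, h413 = `stmt-HodgeConjecture-24833`,
R90-TF section S8 «ContSpec-n½», the `hsrc` supplier estate, census `R90/S8/CENSUS-UnfoldingLetterFree.K2E1-p11-g6.md` f7bfa6fc755d5846 item (b) (S8 dealer R90-CS-plan (g3),
S8-R240 (2) ∕ S8-R246): THE BAD-PLACE READING of the pure-tensor letter `hΩ` AT THE MOVED BASE POINT — at a place `v` where the base point's component is `Φ₃` and the level is
divisible by every `w ∣ v`, the finite witness's local weight is the INDICATOR OF THE VALUATION BALL, in ★ p864821's own `quadraticLocalEquiv` ∕ `toLocalRing` bytes.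
-/
import Summits.HodgeConjecture.HodgeConjecture.Theorems.K2E1ChiMidBlockUnfoldingLetterFreeU3       -- ★ p864965 (this seat): `localReading_on_of_lowerUnitriangular`, `localReading_off_of_lowerUnitriangular` (★ (E-cell) inside the unitary factor)
import Summits.HodgeConjecture.HodgeConjecture.Theorems.K2E1ChiFinReadingEntriesU3               -- ★ p865012 (this seat): `coe_evalPlace_finPart_weylLongU_mul_heisChart_mul_of_evalPlace_eq_antidiag` (the component is `n⁻(−σX_w, Z_w, X_w)`)
import Summits.HodgeConjecture.HodgeConjecture.Theorems.K2E1IntertwiningFiniteHeightDictionaryU3  -- ★ (3-iv-a) (K2E2-p12): `quadraticFiniteAdeleMap_apply_placesOver`, `heisZ_snd_apply_placesOver`; brings ★ `finiteAdeleToLocal_conj`, `traceZeroLine`, `integralBox`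
import HarnessLib

/-!
# K2·E1 ∕ R90·S8 — `K2E1ChiBadPlaceReadingU3`: THE BAD-PLACE READING OF `hΩ` AT THE MOVED BASE POINT — at `v` with `((b₁)_v)_w = Φ₃` and `|𝔫|_w < 1` for every `w ∣ v`, the per-place
# reading of ★ p864965 `hΩ_of_localReadings` holds with the local weight `𝟙{∀ w ∣ v : |X_w|, |σX_w|, |Z_w| ≤ |𝔫|_w}` (★ p864821's `hωS₀` ball, in its `quadraticLocalEquiv` ∕ `toLocalRing` bytes)

Cell `pub/hodgecm-mathlib`, crux h413 = `stmt-HodgeConjecture-24833`, route of record `HCCMUnconditional`; R90-TF section S8 «ContSpec-n½», road R2-χ₃ ((V)∕(R)′ OF RECORD row `hsrc`).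
THEOREMS ONLY (no `def`, no `instance`, no `notation`, no named-fact hypothesis, no `sorry`; default heartbeats); lane `--supports stmt-HodgeConjecture-24833 --as helper` (count-neutral).
Closes no socket.

THE MATHEMATICS ([Rogawski1990] §1.10 p. 9, §4.5 p. 45; [MoeglinWaldspurger1995] II.1.6; [BushnellHenniart2006] §7.1, §12.4; [CasselsFrohlichANT1967] Ch. II §14).  ★ p864821's pure-tensor
letter reads the finite witness `Φ_f` at `U(x) := (ι(w₀)·u((0, Ψ^∞(x₀,x₁)), θ(0,x₂)))_f · b₁`, `x ∈ (𝔸_{L⁺,f})³` (`Ψ^∞ = quadraticFiniteAdeleMap δ`, `θ = traceZeroLine δ`).  By ★ p865012 the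
`w`-component of `U(x)` at a place `v` of `L⁺` where the base point has component `Φ₃` (`((b₁)_v)_w = Φ₃` for all `w ∣ v` — the places of `S₀` for `b₁ = ι_f(w₀^{S₀})`) is the LOWER
UNITRIANGULAR `n⁻ = (1 0 0; −σX_w 1 0; Z_w X_w 1)`, and by the ★ (3-iv-a) dictionary (§1) its entries are, in the base coordinates `p = x|_v ∈ (L⁺_v)³`: `X_w = Ψ_v(p₀,p₁)_w`,
`σX_w = (σ_vΨ_v(p₀,p₁))_w`, `Z_w = (ι_v(p₂)·δ − ι_v(½)·Ψ_v·σ_vΨ_v)_w` — EXACTLY the three quantities of ★ p864821's `hωS₀` ball.  So (§3), with `|𝔫|_w < 1` at every `w ∣ v`, ★ p864965 §3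
(★ (E-cell)) gives: if all three valuations are `≤ |𝔫|_w` at every `w ∣ v` («IN THE BALL») the «on» reading of ★ `hΩ_of_localReadings` holds with `β = 1`, `κ = U(x)_v`, `t_w = 1`, local
character factor `∏_{w∣v} χ₁,w(1) = 1`; otherwise («OFF THE BALL») the «off» reading holds.  §4 packages both as the `v`-disjunct of ★ `hΩ_of_localReadings`' hypothesis `hread` for ANY weight
family `ω` whose `v`-component is ★ p864821's `hωS₀` indicator `𝟙{p ∈ 𝒪_v³ ∧ ball}` — modulo the one remaining local letter «ball ⊆ `𝒪_v³`» (`hbox`; true once `|𝔫|_w ≤ |2δ|_w·|ϖ_w|`,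
the (V) keeper's choice of `𝔫`; next file) and the global finite-support clause of the «off» branch (the assembler's).
* §1 **`snd_quadraticFiniteAdeleMap_apply_placesOver`**, **`conjAdele_snd_apply_placesOver`**, (★ `heisZ_snd_apply_placesOver` is used as is).
* §2 **`coe_evalPlace_bigCell_of_antidiag`** — the component `n⁻` in the `hωS₀` coordinates.
* §3 **`badPlace_localReading_on`** (in the ball), **`badPlace_localReading_off`** (off the ball).
* §4 **`badPlace_hread_of_indicator`** — the `hread x v` disjunct of ★ p864965 for `ω_v = 𝟙{p ∈ 𝒪_v³ ∧ ball}`, modulo `hbox` and the finite-support clause.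
HONEST LABEL: HC_CM is proved only modulo the 7 printed citations (2 remaining named inputs: hLiu418 = `stmt-HodgeConjecture-24832`, h413 = `stmt-HodgeConjecture-24833`) until rung 0
closes; REL ≠ ★ ≠ BUILT; unconditional; asserts no named fact, closes no socket; after this file the `S₀`-part of `hΩ`∕`hωS₀` = ★ modulo {`hbox`, base point `= Φ₃` on `S₀`, `𝔭_w ∣ 𝔫`}; count-neutral.

## References
* [Rogawski1990] J. D. Rogawski, *Automorphic Representations of Unitary Groups in Three Variables*, Ann. of Math. Stud. 123 (1990), §1.10 p. 9, §4.5 p. 45.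
* [MoeglinWaldspurger1995] C. Mœglin, J.-L. Waldspurger, *Spectral Decomposition and Eisenstein Series* (1995), II.1.6.
* [BushnellHenniart2006] C. J. Bushnell, G. Henniart, *The Local Langlands Conjecture for GL(2)* (2006), §7.1, §12.4.
* [CasselsFrohlichANT1967] J. W. S. Cassels, A. Fröhlich (eds.), *Algebraic Number Theory* (1967), Ch. II §14.
-/

set_option autoImplicit false
set_option linter.dupNamespace false  -- the mandated namespace repeats the summit's segment (`HodgeConjecture.HodgeConjecture`)

noncomputable section

open NumberField IsDedekindDomain Filter Set Function
open Literature.NumberTheory.GaloisRepresentations Literature.NumberTheory.GaloisRepresentations.HeckeCharacter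
open Literature.NumberTheory.Automorphic Literature.NumberTheory.Automorphic.UnitaryGroup AdelicGroupData
open Literature.NumberTheory.Automorphic.Arthur2013.Leaves.TECR
open Summit.HodgeConjecture.HodgeConjecture.Cruxes.H413.K2E1ChiMidBlockUnfoldingLetterFreeU3 (localReading_on_of_lowerUnitriangular localReading_off_of_lowerUnitriangular)
open Summit.HodgeConjecture.HodgeConjecture.Cruxes.H413.K2E1ChiFinReadingEntriesU3 (coe_evalPlace_finPart_weylLongU_mul_heisChart_mul_of_evalPlace_eq_antidiag)
open Summit.HodgeConjecture.HodgeConjecture.Cruxes.H413.K2E1IntertwiningFiniteHeightDictionaryU3 (quadraticFiniteAdeleMap_apply_placesOver heisZ_snd_apply_placesOver finiteAdeleToLocal_quadraticFiniteAdeleMap_eq_quadraticLocalEquiv)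

namespace Summit.HodgeConjecture.HodgeConjecture.Cruxes.H413.K2E1ChiBadPlaceReadingU3

variable (L : Type) [Field L] [NumberField L] [IsCMField L] (hc : IsCMField.complexConj L * IsCMField.complexConj L = 1)
  {δ : L} (hcδ : IsCMField.complexConj L δ = -δ) (hδ : δ ≠ 0)

/-! ## §1 The three entries in the `hωS₀` coordinates (★ (3-iv-a) dictionary) -/

/-- `X_w = Ψ_v(p₀,p₁)_w`: the finite adele `(0, Ψ^∞(x₀,x₁))` of `𝔸_L` at `w ∣ v` (★ `quadraticFiniteAdeleMap_apply_placesOver`). [cite: CasselsFrohlichANT1967, Ch. II §14] -/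
theorem snd_quadraticFiniteAdeleMap_apply_placesOver (x : Fin 3 → FiniteAdeleRing (𝓞 ↥(maximalRealSubfield L)) ↥(maximalRealSubfield L))
    (v : HeightOneSpectrum (𝓞 ↥(maximalRealSubfield L))) (w : PlacesOver L v) :
    ((((0 : InfiniteAdeleRing L)), quadraticFiniteAdeleMap ↥(maximalRealSubfield L) L δ (x 0, x 1)) : AdeleRing (𝓞 L) L).2 w.1 =
      quadraticLocalEquiv L v (IsCMField.complexConj L) hcδ hδ (x 0 v, x 1 v) w :=
  quadraticFiniteAdeleMap_apply_placesOver L hcδ hδ (x 0) (x 1) v w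

/-- `σX_w = (σ_v Ψ_v(p₀,p₁))_w`: the conjugate `c(0, Ψ^∞(x₀,x₁))` at `w ∣ v` (★ `conjAdele_snd`, ★ `finiteAdeleToLocal_conj`, §1). [cite: CasselsFrohlichANT1967, Ch. II §14] -/
theorem conjAdele_snd_apply_placesOver (x : Fin 3 → FiniteAdeleRing (𝓞 ↥(maximalRealSubfield L)) ↥(maximalRealSubfield L))
    (v : HeightOneSpectrum (𝓞 ↥(maximalRealSubfield L))) (w : PlacesOver L v) :
    (conjAdele (↥(maximalRealSubfield L)) L (IsCMField.complexConj L) ((((0 : InfiniteAdeleRing L)), quadraticFiniteAdeleMap ↥(maximalRealSubfield L) L δ (x 0, x 1)) : AdeleRing (𝓞 L) L)).2 w.1 =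
      conjLocal L (IsCMField.complexConj L) v (quadraticLocalEquiv L v (IsCMField.complexConj L) hcδ hδ (x 0 v, x 1 v)) w := by
  rw [conjAdele_snd, ← finiteAdeleToLocal_apply L v _ w, finiteAdeleToLocal_conj]
  have h : finiteAdeleToLocal L v ((((0 : InfiniteAdeleRing L)), quadraticFiniteAdeleMap ↥(maximalRealSubfield L) L δ (x 0, x 1)) : AdeleRing (𝓞 L) L).2 =
      quadraticLocalEquiv L v (IsCMField.complexConj L) hcδ hδ (x 0 v, x 1 v) :=
    finiteAdeleToLocal_quadraticFiniteAdeleMap_eq_quadraticLocalEquiv L hcδ hδ (x 0) (x 1) v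
  rw [h]

/-! ## §2 The component at a `Φ₃`-place of the base point, in the `hωS₀` coordinates -/

/-- **THE LOWER UNITRIANGULAR COMPONENT IN ★ p864821's COORDINATES**: at a place `v` of `L⁺` with `((b₁)_v)_w = Φ₃`, the `w`-component of `U(x) = (ι(w₀)·u((0,Ψ^∞(x₀,x₁)), θ(0,x₂)))_f · b₁` is
`(1 0 0; −(σ_vΨ_v(p₀,p₁))_w 1 0; (ι_v(p₂)δ − ι_v(½)Ψ_vσ_vΨ_v)_w (Ψ_v(p₀,p₁))_w 1)`, `p = x|_v` (★ p865012 ∘ §1 ∘ ★ `heisZ_snd_apply_placesOver`). [cite: Rogawski1990, §1.10 p. 9, §4.5 p. 45] -/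
theorem coe_evalPlace_bigCell_of_antidiag (x : Fin 3 → FiniteAdeleRing (𝓞 ↥(maximalRealSubfield L)) ↥(maximalRealSubfield L))
    (b₁ : ↥(finAdelic (↥(maximalRealSubfield L)) L (IsCMField.complexConj L) 3 ((StdForm.antidiagonal 3).over L))) (v : HeightOneSpectrum (𝓞 ↥(maximalRealSubfield L))) (w : PlacesOver L v)
    (hb₁ : ((((evalPlace (↥(maximalRealSubfield L)) L (IsCMField.complexConj L) 3 ((StdForm.antidiagonal 3).over L) v b₁ : localPi L (IsCMField.complexConj L) 3 ((StdForm.antidiagonal 3).over L) v) : LocalGLPi L 3 v) w :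
      GL (Fin 3) (w.1.adicCompletion L)) : Matrix (Fin 3) (Fin 3) (w.1.adicCompletion L)) = !![0, 0, 1; 0, 1, 0; 1, 0, 0]) :
    ((((evalPlace (↥(maximalRealSubfield L)) L (IsCMField.complexConj L) 3 ((StdForm.antidiagonal 3).over L) v
        (finPart (↥(maximalRealSubfield L)) L (IsCMField.complexConj L) 3 ((StdForm.antidiagonal 3).over L)
          ((quasiSplit (↥(maximalRealSubfield L)) L (IsCMField.complexConj L) 3).toAdelic (weylLongU ((IsCMField.complexConj L : L ≃ₐ[↥(maximalRealSubfield L)] L) : L →+* L) (rfl : (StdForm.antidiagonal 3).over L = (StdForm.antidiagonal 3).over L)) *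
            ((heisChart hc (((((0 : InfiniteAdeleRing L)), quadraticFiniteAdeleMap ↥(maximalRealSubfield L) L δ (x 0, x 1)) : AdeleRing (𝓞 L) L),
              traceZeroLine ↥(maximalRealSubfield L) L (IsCMField.complexConj L) hcδ hδ ((0, x 2) : AdeleRing (𝓞 ↥(maximalRealSubfield L)) ↥(maximalRealSubfield L))) :
                ↥(adelicUnipotent ↥(maximalRealSubfield L) L (IsCMField.complexConj L) 3)) : (quasiSplit (↥(maximalRealSubfield L)) L (IsCMField.complexConj L) 3).Adelic)) * b₁) :
        localPi L (IsCMField.complexConj L) 3 ((StdForm.antidiagonal 3).over L) v) : LocalGLPi L 3 v) w : GL (Fin 3) (w.1.adicCompletion L)) : Matrix (Fin 3) (Fin 3) (w.1.adicCompletion L)) =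
      !![1, 0, 0;
        -(conjLocal L (IsCMField.complexConj L) v (quadraticLocalEquiv L v (IsCMField.complexConj L) hcδ hδ (x 0 v, x 1 v)) w), 1, 0;
        (toLocalRing L v (x 2 v) * algebraMap L (LocalRing L v) δ -
          toLocalRing L v 2⁻¹ * (quadraticLocalEquiv L v (IsCMField.complexConj L) hcδ hδ (x 0 v, x 1 v) *
            conjLocal L (IsCMField.complexConj L) v (quadraticLocalEquiv L v (IsCMField.complexConj L) hcδ hδ (x 0 v, x 1 v)))) w,
        quadraticLocalEquiv L v (IsCMField.complexConj L) hcδ hδ (x 0 v, x 1 v) w, 1] := by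
  rw [coe_evalPlace_finPart_weylLongU_mul_heisChart_mul_of_evalPlace_eq_antidiag L hc _ _ b₁ v w hb₁, conjAdele_snd_apply_placesOver L hcδ hδ x v w,
    snd_quadraticFiniteAdeleMap_apply_placesOver L hcδ hδ x v w, heisZ_snd_apply_placesOver L hcδ hδ (0 : InfiniteAdeleRing L) (x 0) (x 1) (x 2) v w]

/-! ## §3 The readings: in the ball («on», `β = 1`) and off the ball («off») -/

/-- **IN THE BALL — THE «ON» READING WITH `β = 1`.**  At a place `v` of `L⁺` with `((b₁)_v)_w = Φ₃` and `|𝔫|_w < 1` for every `w ∣ v`: if `p = x|_v` satisfies, at every `w ∣ v`,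
`|Ψ_v(p₀,p₁)_w| ≤ |𝔫|_w`, `|(σ_vΨ_v)_w| ≤ |𝔫|_w`, `|(ι_v(p₂)δ − ι_v(½)Ψ_vσ_vΨ_v)_w| ≤ |𝔫|_w` (★ p864821's `hωS₀` ball conditions), then `U(x)_v ∈ K_v(𝔫)` and the «on» reading of ★
`hΩ_of_localReadings` holds with `β = 1`, `κ = U(x)_v`, `t_w = 1` — whose character factor `∏_{w∣v} χ_w(1)` is `1` for EVERY family of local characters (★ p864965 §3 ∘ §2).
[cite: BushnellHenniart2006, §12.4] [cite: Rogawski1990, §4.5 p. 45] -/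
theorem badPlace_localReading_on (𝔫 : Ideal (𝓞 L)) (x : Fin 3 → FiniteAdeleRing (𝓞 ↥(maximalRealSubfield L)) ↥(maximalRealSubfield L))
    (b₁ : ↥(finAdelic (↥(maximalRealSubfield L)) L (IsCMField.complexConj L) 3 ((StdForm.antidiagonal 3).over L))) (v : HeightOneSpectrum (𝓞 ↥(maximalRealSubfield L)))
    (hb₁ : ∀ w : PlacesOver L v, ((((evalPlace (↥(maximalRealSubfield L)) L (IsCMField.complexConj L) 3 ((StdForm.antidiagonal 3).over L) v b₁ : localPi L (IsCMField.complexConj L) 3 ((StdForm.antidiagonal 3).over L) v) : LocalGLPi L 3 v) w :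
      GL (Fin 3) (w.1.adicCompletion L)) : Matrix (Fin 3) (Fin 3) (w.1.adicCompletion L)) = !![0, 0, 1; 0, 1, 0; 1, 0, 0])
    (h𝔫 : ∀ w : PlacesOver L v, idealRadius L w.1 𝔫 < 1)
    (hball : ∀ w : PlacesOver L v,
      Valued.v (quadraticLocalEquiv L v (IsCMField.complexConj L) hcδ hδ (x 0 v, x 1 v) w) ≤ idealRadius L w.1 𝔫 ∧
      Valued.v (conjLocal L (IsCMField.complexConj L) v (quadraticLocalEquiv L v (IsCMField.complexConj L) hcδ hδ (x 0 v, x 1 v)) w) ≤ idealRadius L w.1 𝔫 ∧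
      Valued.v ((toLocalRing L v (x 2 v) * algebraMap L (LocalRing L v) δ -
        toLocalRing L v 2⁻¹ * (quadraticLocalEquiv L v (IsCMField.complexConj L) hcδ hδ (x 0 v, x 1 v) *
          conjLocal L (IsCMField.complexConj L) v (quadraticLocalEquiv L v (IsCMField.complexConj L) hcδ hδ (x 0 v, x 1 v)))) w) ≤ idealRadius L w.1 𝔫) :
    (∀ w : PlacesOver L v, ((((1 : localPi L (IsCMField.complexConj L) 3 ((StdForm.antidiagonal 3).over L) v) : LocalGLPi L 3 v) w : GL (Fin 3) (w.1.adicCompletion L)) :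
        Matrix (Fin 3) (Fin 3) (w.1.adicCompletion L)).BlockTriangular id) ∧
    (∀ w : PlacesOver L v, ((evalPlace (↥(maximalRealSubfield L)) L (IsCMField.complexConj L) 3 ((StdForm.antidiagonal 3).over L) v
        (finPart (↥(maximalRealSubfield L)) L (IsCMField.complexConj L) 3 ((StdForm.antidiagonal 3).over L)
          ((quasiSplit (↥(maximalRealSubfield L)) L (IsCMField.complexConj L) 3).toAdelic (weylLongU ((IsCMField.complexConj L : L ≃ₐ[↥(maximalRealSubfield L)] L) : L →+* L) (rfl : (StdForm.antidiagonal 3).over L = (StdForm.antidiagonal 3).over L)) *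
            ((heisChart hc (((((0 : InfiniteAdeleRing L)), quadraticFiniteAdeleMap ↥(maximalRealSubfield L) L δ (x 0, x 1)) : AdeleRing (𝓞 L) L),
              traceZeroLine ↥(maximalRealSubfield L) L (IsCMField.complexConj L) hcδ hδ ((0, x 2) : AdeleRing (𝓞 ↥(maximalRealSubfield L)) ↥(maximalRealSubfield L))) :
                ↥(adelicUnipotent ↥(maximalRealSubfield L) L (IsCMField.complexConj L) 3)) : (quasiSplit (↥(maximalRealSubfield L)) L (IsCMField.complexConj L) 3).Adelic)) * b₁) :
        localPi L (IsCMField.complexConj L) 3 ((StdForm.antidiagonal 3).over L) v) : LocalGLPi L 3 v) w ∈ valuedCongruenceSubgroup (Fin 3) (idealRadius L w.1 𝔫)) ∧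
    evalPlace (↥(maximalRealSubfield L)) L (IsCMField.complexConj L) 3 ((StdForm.antidiagonal 3).over L) v
        (finPart (↥(maximalRealSubfield L)) L (IsCMField.complexConj L) 3 ((StdForm.antidiagonal 3).over L)
          ((quasiSplit (↥(maximalRealSubfield L)) L (IsCMField.complexConj L) 3).toAdelic (weylLongU ((IsCMField.complexConj L : L ≃ₐ[↥(maximalRealSubfield L)] L) : L →+* L) (rfl : (StdForm.antidiagonal 3).over L = (StdForm.antidiagonal 3).over L)) *
            ((heisChart hc (((((0 : InfiniteAdeleRing L)), quadraticFiniteAdeleMap ↥(maximalRealSubfield L) L δ (x 0, x 1)) : AdeleRing (𝓞 L) L),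
              traceZeroLine ↥(maximalRealSubfield L) L (IsCMField.complexConj L) hcδ hδ ((0, x 2) : AdeleRing (𝓞 ↥(maximalRealSubfield L)) ↥(maximalRealSubfield L))) :
                ↥(adelicUnipotent ↥(maximalRealSubfield L) L (IsCMField.complexConj L) 3)) : (quasiSplit (↥(maximalRealSubfield L)) L (IsCMField.complexConj L) 3).Adelic)) * b₁) =
      1 * evalPlace (↥(maximalRealSubfield L)) L (IsCMField.complexConj L) 3 ((StdForm.antidiagonal 3).over L) v
        (finPart (↥(maximalRealSubfield L)) L (IsCMField.complexConj L) 3 ((StdForm.antidiagonal 3).over L)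
          ((quasiSplit (↥(maximalRealSubfield L)) L (IsCMField.complexConj L) 3).toAdelic (weylLongU ((IsCMField.complexConj L : L ≃ₐ[↥(maximalRealSubfield L)] L) : L →+* L) (rfl : (StdForm.antidiagonal 3).over L = (StdForm.antidiagonal 3).over L)) *
            ((heisChart hc (((((0 : InfiniteAdeleRing L)), quadraticFiniteAdeleMap ↥(maximalRealSubfield L) L δ (x 0, x 1)) : AdeleRing (𝓞 L) L),
              traceZeroLine ↥(maximalRealSubfield L) L (IsCMField.complexConj L) hcδ hδ ((0, x 2) : AdeleRing (𝓞 ↥(maximalRealSubfield L)) ↥(maximalRealSubfield L))) :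
                ↥(adelicUnipotent ↥(maximalRealSubfield L) L (IsCMField.complexConj L) 3)) : (quasiSplit (↥(maximalRealSubfield L)) L (IsCMField.complexConj L) 3).Adelic)) * b₁) ∧
    (∀ w : PlacesOver L v, (((1 : (w.1.adicCompletion L)ˣ) : (w.1.adicCompletion L)ˣ) : w.1.adicCompletion L) =
        ((((1 : localPi L (IsCMField.complexConj L) 3 ((StdForm.antidiagonal 3).over L) v) : LocalGLPi L 3 v) w : GL (Fin 3) (w.1.adicCompletion L)) : Matrix (Fin 3) (Fin 3) (w.1.adicCompletion L)) 0 0) ∧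
    (∀ χw : ∀ w : PlacesOver L v, (w.1.adicCompletion L)ˣ →* ℂˣ, ∏ w : PlacesOver L v, ((χw w (1 : (w.1.adicCompletion L)ˣ) : ℂˣ) : ℂ) = 1) :=
  localReading_on_of_lowerUnitriangular L 𝔫 _
    (fun w => -(conjLocal L (IsCMField.complexConj L) v (quadraticLocalEquiv L v (IsCMField.complexConj L) hcδ hδ (x 0 v, x 1 v)) w))
    (fun w => (toLocalRing L v (x 2 v) * algebraMap L (LocalRing L v) δ -
      toLocalRing L v 2⁻¹ * (quadraticLocalEquiv L v (IsCMField.complexConj L) hcδ hδ (x 0 v, x 1 v) *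
        conjLocal L (IsCMField.complexConj L) v (quadraticLocalEquiv L v (IsCMField.complexConj L) hcδ hδ (x 0 v, x 1 v)))) w)
    (fun w => quadraticLocalEquiv L v (IsCMField.complexConj L) hcδ hδ (x 0 v, x 1 v) w)
    (fun w => coe_evalPlace_bigCell_of_antidiag L hc hcδ hδ x b₁ v w (hb₁ w)) h𝔫
    (fun w => ⟨by rw [Valuation.map_neg]; exact (hball w).2.1, (hball w).2.2, (hball w).1⟩)

/-- **OFF THE BALL — THE «OFF» READING.**  At a place `v` of `L⁺` with `((b₁)_v)_w = Φ₃` and `|𝔫|_w < 1` for every `w ∣ v`: if the three ball conditions FAIL at some `w ∣ v`, then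
`U(x)_v ∉ B_v·K_v(𝔫)` — the «off» reading of ★ `hΩ_of_localReadings` (★ p864965 §3 ∘ §2). [cite: BushnellHenniart2006, §7.1, §12.4] [cite: Rogawski1990, §4.5 p. 45] -/
theorem badPlace_localReading_off (𝔫 : Ideal (𝓞 L)) (x : Fin 3 → FiniteAdeleRing (𝓞 ↥(maximalRealSubfield L)) ↥(maximalRealSubfield L))
    (b₁ : ↥(finAdelic (↥(maximalRealSubfield L)) L (IsCMField.complexConj L) 3 ((StdForm.antidiagonal 3).over L))) (v : HeightOneSpectrum (𝓞 ↥(maximalRealSubfield L)))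
    (hb₁ : ∀ w : PlacesOver L v, ((((evalPlace (↥(maximalRealSubfield L)) L (IsCMField.complexConj L) 3 ((StdForm.antidiagonal 3).over L) v b₁ : localPi L (IsCMField.complexConj L) 3 ((StdForm.antidiagonal 3).over L) v) : LocalGLPi L 3 v) w :
      GL (Fin 3) (w.1.adicCompletion L)) : Matrix (Fin 3) (Fin 3) (w.1.adicCompletion L)) = !![0, 0, 1; 0, 1, 0; 1, 0, 0])
    (h𝔫 : ∀ w : PlacesOver L v, idealRadius L w.1 𝔫 < 1)
    (hoff : ¬ ∀ w : PlacesOver L v,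
      Valued.v (quadraticLocalEquiv L v (IsCMField.complexConj L) hcδ hδ (x 0 v, x 1 v) w) ≤ idealRadius L w.1 𝔫 ∧
      Valued.v (conjLocal L (IsCMField.complexConj L) v (quadraticLocalEquiv L v (IsCMField.complexConj L) hcδ hδ (x 0 v, x 1 v)) w) ≤ idealRadius L w.1 𝔫 ∧
      Valued.v ((toLocalRing L v (x 2 v) * algebraMap L (LocalRing L v) δ -
        toLocalRing L v 2⁻¹ * (quadraticLocalEquiv L v (IsCMField.complexConj L) hcδ hδ (x 0 v, x 1 v) *
          conjLocal L (IsCMField.complexConj L) v (quadraticLocalEquiv L v (IsCMField.complexConj L) hcδ hδ (x 0 v, x 1 v)))) w) ≤ idealRadius L w.1 𝔫) :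
    ∀ β κ : localPi L (IsCMField.complexConj L) 3 ((StdForm.antidiagonal 3).over L) v,
      (∀ w : PlacesOver L v, ((((β : localPi L (IsCMField.complexConj L) 3 ((StdForm.antidiagonal 3).over L) v) : LocalGLPi L 3 v) w : GL (Fin 3) (w.1.adicCompletion L)) :
        Matrix (Fin 3) (Fin 3) (w.1.adicCompletion L)).BlockTriangular id) →
      (∀ w : PlacesOver L v, ((κ : localPi L (IsCMField.complexConj L) 3 ((StdForm.antidiagonal 3).over L) v) : LocalGLPi L 3 v) w ∈ valuedCongruenceSubgroup (Fin 3) (idealRadius L w.1 𝔫)) →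
      evalPlace (↥(maximalRealSubfield L)) L (IsCMField.complexConj L) 3 ((StdForm.antidiagonal 3).over L) v
        (finPart (↥(maximalRealSubfield L)) L (IsCMField.complexConj L) 3 ((StdForm.antidiagonal 3).over L)
          ((quasiSplit (↥(maximalRealSubfield L)) L (IsCMField.complexConj L) 3).toAdelic (weylLongU ((IsCMField.complexConj L : L ≃ₐ[↥(maximalRealSubfield L)] L) : L →+* L) (rfl : (StdForm.antidiagonal 3).over L = (StdForm.antidiagonal 3).over L)) *
            ((heisChart hc (((((0 : InfiniteAdeleRing L)), quadraticFiniteAdeleMap ↥(maximalRealSubfield L) L δ (x 0, x 1)) : AdeleRing (𝓞 L) L),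
              traceZeroLine ↥(maximalRealSubfield L) L (IsCMField.complexConj L) hcδ hδ ((0, x 2) : AdeleRing (𝓞 ↥(maximalRealSubfield L)) ↥(maximalRealSubfield L))) :
                ↥(adelicUnipotent ↥(maximalRealSubfield L) L (IsCMField.complexConj L) 3)) : (quasiSplit (↥(maximalRealSubfield L)) L (IsCMField.complexConj L) 3).Adelic)) * b₁) ≠ β * κ := by
  obtain ⟨w₁, hw₁⟩ := not_forall.1 hoff
  refine localReading_off_of_lowerUnitriangular L 𝔫 _
    (fun w => -(conjLocal L (IsCMField.complexConj L) v (quadraticLocalEquiv L v (IsCMField.complexConj L) hcδ hδ (x 0 v, x 1 v)) w))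
    (fun w => (toLocalRing L v (x 2 v) * algebraMap L (LocalRing L v) δ -
      toLocalRing L v 2⁻¹ * (quadraticLocalEquiv L v (IsCMField.complexConj L) hcδ hδ (x 0 v, x 1 v) *
        conjLocal L (IsCMField.complexConj L) v (quadraticLocalEquiv L v (IsCMField.complexConj L) hcδ hδ (x 0 v, x 1 v)))) w)
    (fun w => quadraticLocalEquiv L v (IsCMField.complexConj L) hcδ hδ (x 0 v, x 1 v) w)
    (fun w => coe_evalPlace_bigCell_of_antidiag L hc hcδ hδ x b₁ v w (hb₁ w)) h𝔫 (w₁ := w₁) ?_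
  rw [Valuation.map_neg]
  exact fun h => hw₁ ⟨h.2.2, h.1, h.2.1⟩

/-! ## §4 The `v`-disjunct of ★ p864965 `hΩ_of_localReadings`' `hread`, for the `hωS₀` indicator weight -/

/-- **THE BAD-PLACE DISJUNCT OF `hread` FOR ★ p864821's INDICATOR WEIGHT.**  Let `ω` be any weight family whose `v`-component is ★ p864821's `hωS₀` indicator
`𝟙{p ∈ 𝒪_v³ ∧ ∀ w∣v : |Ψ_v(p₀,p₁)_w|, |(σΨ_v)_w|, |(ι_v(p₂)δ − ι_v(½)Ψ_vσΨ_v)_w| ≤ |𝔫|_w}` (`hωv`), at a place `v` with `((b₁)_v)_w = Φ₃` and `|𝔫|_w < 1` for every `w ∣ v`.  Modulo the local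
letter `hbox` «the valuation ball lies in `𝒪_v³`» (true for `|𝔫|_w ≤ |2δ|_w·|ϖ_w|`; the level of record's business) and, in the «off» branch, the global finite-support clause `hfin`
(the assembler's), the per-place reading `hread x v` of ★ `hΩ_of_localReadings` HOLDS for every `x`: «on» in the ball (weight `1 = ∏_w χ₁,w(1)`), «off» off it (weight `0`).
[cite: MoeglinWaldspurger1995, II.1.6] [cite: BushnellHenniart2006, §7.1, §12.4] [cite: Rogawski1990, §4.5 p. 45] -/
theorem badPlace_hread_of_indicator (χ₁ : HeckeCharacter L) (𝔫 : Ideal (𝓞 L))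
    (b₁ : ↥(finAdelic (↥(maximalRealSubfield L)) L (IsCMField.complexConj L) 3 ((StdForm.antidiagonal 3).over L))) (v : HeightOneSpectrum (𝓞 ↥(maximalRealSubfield L)))
    (hb₁ : ∀ w : PlacesOver L v, ((((evalPlace (↥(maximalRealSubfield L)) L (IsCMField.complexConj L) 3 ((StdForm.antidiagonal 3).over L) v b₁ : localPi L (IsCMField.complexConj L) 3 ((StdForm.antidiagonal 3).over L) v) : LocalGLPi L 3 v) w :
      GL (Fin 3) (w.1.adicCompletion L)) : Matrix (Fin 3) (Fin 3) (w.1.adicCompletion L)) = !![0, 0, 1; 0, 1, 0; 1, 0, 0])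
    (h𝔫 : ∀ w : PlacesOver L v, idealRadius L w.1 𝔫 < 1)
    (ω : ∀ v : HeightOneSpectrum (𝓞 ↥(maximalRealSubfield L)), (Fin 3 → v.adicCompletion ↥(maximalRealSubfield L)) → ℂ)
    (hωv : ω v = Set.indicator {p : Fin 3 → v.adicCompletion ↥(maximalRealSubfield L) | p ∈ integralBox ↥(maximalRealSubfield L) (Fin 3) v ∧ ∀ w' : PlacesOver L v,
              Valued.v (quadraticLocalEquiv L v (IsCMField.complexConj L) hcδ hδ (p 0, p 1) w') ≤ idealRadius L w'.1 𝔫 ∧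
              Valued.v (conjLocal L (IsCMField.complexConj L) v (quadraticLocalEquiv L v (IsCMField.complexConj L) hcδ hδ (p 0, p 1)) w') ≤ idealRadius L w'.1 𝔫 ∧
              Valued.v ((toLocalRing L v (p 2) * algebraMap L (LocalRing L v) δ -
                toLocalRing L v 2⁻¹ * (quadraticLocalEquiv L v (IsCMField.complexConj L) hcδ hδ (p 0, p 1) * conjLocal L (IsCMField.complexConj L) v (quadraticLocalEquiv L v (IsCMField.complexConj L) hcδ hδ (p 0, p 1)))) w') ≤ idealRadius L w'.1 𝔫}
            (fun _ => (1 : ℂ)))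
    -- the local letter «ball ⊆ `𝒪_v³`» (the level of record absorbs `2δ·𝔭_w`)
    (hbox : ∀ p : Fin 3 → v.adicCompletion ↥(maximalRealSubfield L), (∀ w' : PlacesOver L v,
              Valued.v (quadraticLocalEquiv L v (IsCMField.complexConj L) hcδ hδ (p 0, p 1) w') ≤ idealRadius L w'.1 𝔫 ∧
              Valued.v (conjLocal L (IsCMField.complexConj L) v (quadraticLocalEquiv L v (IsCMField.complexConj L) hcδ hδ (p 0, p 1)) w') ≤ idealRadius L w'.1 𝔫 ∧
              Valued.v ((toLocalRing L v (p 2) * algebraMap L (LocalRing L v) δ -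
                toLocalRing L v 2⁻¹ * (quadraticLocalEquiv L v (IsCMField.complexConj L) hcδ hδ (p 0, p 1) * conjLocal L (IsCMField.complexConj L) v (quadraticLocalEquiv L v (IsCMField.complexConj L) hcδ hδ (p 0, p 1)))) w') ≤ idealRadius L w'.1 𝔫) →
            p ∈ integralBox ↥(maximalRealSubfield L) (Fin 3) v)
    (x : Fin 3 → FiniteAdeleRing (𝓞 ↥(maximalRealSubfield L)) ↥(maximalRealSubfield L))
    -- the global finite-support clause of the «off» branch (the assembler's)
    (hfin : (mulSupport fun v' : HeightOneSpectrum (𝓞 ↥(maximalRealSubfield L)) => ω v' (fun i => x i v')).Finite) :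
    (∃ (β κ : localPi L (IsCMField.complexConj L) 3 ((StdForm.antidiagonal 3).over L) v) (t : ∀ w : PlacesOver L v, (w.1.adicCompletion L)ˣ),
        (∀ w : PlacesOver L v, ((((β : localPi L (IsCMField.complexConj L) 3 ((StdForm.antidiagonal 3).over L) v) : LocalGLPi L 3 v) w : GL (Fin 3) (w.1.adicCompletion L)) :
          Matrix (Fin 3) (Fin 3) (w.1.adicCompletion L)).BlockTriangular id) ∧
        (∀ w : PlacesOver L v, ((κ : localPi L (IsCMField.complexConj L) 3 ((StdForm.antidiagonal 3).over L) v) : LocalGLPi L 3 v) w ∈ valuedCongruenceSubgroup (Fin 3) (idealRadius L w.1 𝔫)) ∧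
        evalPlace (↥(maximalRealSubfield L)) L (IsCMField.complexConj L) 3 ((StdForm.antidiagonal 3).over L) v
          (finPart (↥(maximalRealSubfield L)) L (IsCMField.complexConj L) 3 ((StdForm.antidiagonal 3).over L)
            ((quasiSplit (↥(maximalRealSubfield L)) L (IsCMField.complexConj L) 3).toAdelic (weylLongU ((IsCMField.complexConj L : L ≃ₐ[↥(maximalRealSubfield L)] L) : L →+* L) (rfl : (StdForm.antidiagonal 3).over L = (StdForm.antidiagonal 3).over L)) *
              ((heisChart hc (((((0 : InfiniteAdeleRing L)), quadraticFiniteAdeleMap ↥(maximalRealSubfield L) L δ (x 0, x 1)) : AdeleRing (𝓞 L) L),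
                traceZeroLine ↥(maximalRealSubfield L) L (IsCMField.complexConj L) hcδ hδ ((0, x 2) : AdeleRing (𝓞 ↥(maximalRealSubfield L)) ↥(maximalRealSubfield L))) :
                  ↥(adelicUnipotent ↥(maximalRealSubfield L) L (IsCMField.complexConj L) 3)) : (quasiSplit (↥(maximalRealSubfield L)) L (IsCMField.complexConj L) 3).Adelic)) * b₁) = β * κ ∧
        (∀ w : PlacesOver L v, ((t w : (w.1.adicCompletion L)ˣ) : w.1.adicCompletion L) =
          ((((β : localPi L (IsCMField.complexConj L) 3 ((StdForm.antidiagonal 3).over L) v) : LocalGLPi L 3 v) w : GL (Fin 3) (w.1.adicCompletion L)) : Matrix (Fin 3) (Fin 3) (w.1.adicCompletion L)) 0 0) ∧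
        ω v (fun i => x i v) = ∏ w : PlacesOver L v, ((χ₁.localComponent w.1 (t w) : ℂˣ) : ℂ)) ∨
      ((∀ β κ : localPi L (IsCMField.complexConj L) 3 ((StdForm.antidiagonal 3).over L) v,
        (∀ w : PlacesOver L v, ((((β : localPi L (IsCMField.complexConj L) 3 ((StdForm.antidiagonal 3).over L) v) : LocalGLPi L 3 v) w : GL (Fin 3) (w.1.adicCompletion L)) :
          Matrix (Fin 3) (Fin 3) (w.1.adicCompletion L)).BlockTriangular id) →
        (∀ w : PlacesOver L v, ((κ : localPi L (IsCMField.complexConj L) 3 ((StdForm.antidiagonal 3).over L) v) : LocalGLPi L 3 v) w ∈ valuedCongruenceSubgroup (Fin 3) (idealRadius L w.1 𝔫)) →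
        evalPlace (↥(maximalRealSubfield L)) L (IsCMField.complexConj L) 3 ((StdForm.antidiagonal 3).over L) v
          (finPart (↥(maximalRealSubfield L)) L (IsCMField.complexConj L) 3 ((StdForm.antidiagonal 3).over L)
            ((quasiSplit (↥(maximalRealSubfield L)) L (IsCMField.complexConj L) 3).toAdelic (weylLongU ((IsCMField.complexConj L : L ≃ₐ[↥(maximalRealSubfield L)] L) : L →+* L) (rfl : (StdForm.antidiagonal 3).over L = (StdForm.antidiagonal 3).over L)) *
              ((heisChart hc (((((0 : InfiniteAdeleRing L)), quadraticFiniteAdeleMap ↥(maximalRealSubfield L) L δ (x 0, x 1)) : AdeleRing (𝓞 L) L),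
                traceZeroLine ↥(maximalRealSubfield L) L (IsCMField.complexConj L) hcδ hδ ((0, x 2) : AdeleRing (𝓞 ↥(maximalRealSubfield L)) ↥(maximalRealSubfield L))) :
                  ↥(adelicUnipotent ↥(maximalRealSubfield L) L (IsCMField.complexConj L) 3)) : (quasiSplit (↥(maximalRealSubfield L)) L (IsCMField.complexConj L) 3).Adelic)) * b₁) ≠ β * κ) ∧
        ω v (fun i => x i v) = 0 ∧ (mulSupport fun v' : HeightOneSpectrum (𝓞 ↥(maximalRealSubfield L)) => ω v' (fun i => x i v')).Finite) := by
  by_cases hball : ∀ w : PlacesOver L v,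
      Valued.v (quadraticLocalEquiv L v (IsCMField.complexConj L) hcδ hδ (x 0 v, x 1 v) w) ≤ idealRadius L w.1 𝔫 ∧
      Valued.v (conjLocal L (IsCMField.complexConj L) v (quadraticLocalEquiv L v (IsCMField.complexConj L) hcδ hδ (x 0 v, x 1 v)) w) ≤ idealRadius L w.1 𝔫 ∧
      Valued.v ((toLocalRing L v (x 2 v) * algebraMap L (LocalRing L v) δ -
        toLocalRing L v 2⁻¹ * (quadraticLocalEquiv L v (IsCMField.complexConj L) hcδ hδ (x 0 v, x 1 v) *
          conjLocal L (IsCMField.complexConj L) v (quadraticLocalEquiv L v (IsCMField.complexConj L) hcδ hδ (x 0 v, x 1 v)))) w) ≤ idealRadius L w.1 𝔫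
  · -- «on»: `β = 1`, `κ = U(x)_v`, `t = 1`; the weight is `1 = ∏_w χ₁,w(1)`
    obtain ⟨h1, hκ, hu, ht, hprod⟩ := badPlace_localReading_on L hc hcδ hδ 𝔫 x b₁ v hb₁ h𝔫 hball
    refine Or.inl ⟨1, _, fun _ => 1, h1, hκ, hu, ht, ?_⟩
    have hmem : (fun i => x i v) ∈ {p : Fin 3 → v.adicCompletion ↥(maximalRealSubfield L) | p ∈ integralBox ↥(maximalRealSubfield L) (Fin 3) v ∧ ∀ w' : PlacesOver L v,
              Valued.v (quadraticLocalEquiv L v (IsCMField.complexConj L) hcδ hδ (p 0, p 1) w') ≤ idealRadius L w'.1 𝔫 ∧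
              Valued.v (conjLocal L (IsCMField.complexConj L) v (quadraticLocalEquiv L v (IsCMField.complexConj L) hcδ hδ (p 0, p 1)) w') ≤ idealRadius L w'.1 𝔫 ∧
              Valued.v ((toLocalRing L v (p 2) * algebraMap L (LocalRing L v) δ -
                toLocalRing L v 2⁻¹ * (quadraticLocalEquiv L v (IsCMField.complexConj L) hcδ hδ (p 0, p 1) * conjLocal L (IsCMField.complexConj L) v (quadraticLocalEquiv L v (IsCMField.complexConj L) hcδ hδ (p 0, p 1)))) w') ≤ idealRadius L w'.1 𝔫} :=
      ⟨hbox _ hball, hball⟩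
    rw [hωv, Set.indicator_of_mem hmem, hprod fun w => χ₁.localComponent w.1]
  · -- «off»: the component lies off `B_v·K_v(𝔫)`, the weight is `0`
    refine Or.inr ⟨badPlace_localReading_off L hc hcδ hδ 𝔫 x b₁ v hb₁ h𝔫 hball, ?_, hfin⟩
    rw [hωv]
    exact Set.indicator_of_notMem (fun h => hball h.2) _

end Summit.HodgeConjecture.HodgeConjecture.Cruxes.H413.K2E1ChiBadPlaceReadingU3

end
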